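import Summits.BirchSwinnertonDyer.BirchSwinnertonDyer.Theorems.AdditiveBranchIMCMultLowerLambdaAdicIff
import Summits.BirchSwinnertonDyer.BirchSwinnertonDyer.Theorems.AdditiveBranchIMCMultLowerLambdaAdicRed
import Summits.BirchSwinnertonDyer.Rank1Residual.AdditivePotMult.TamagawaAtP
import HarnessLib

/-!
# Route `AdditiveBranchIMC` (rung K1), crux `MultLower` (item `stmt-BirchSwinnertonDyer-19359`):
# the (M) iff on the REDUCIBLE rows X3♯(M) (every odd `p`) and on the whole cell (M) (`p ≥ 5`, `Irr → Surj`)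

Cell `bsd-addord`, seat `bsd-addord-k1-c4` (gen 2). Sibling of `AdditiveBranchIMCMultLowerLambdaAdicIff.lean`
(X4(M) ∩ surj): the same ascent with Wuthrich 2014 Thm. 16 read on the `ω^{(p−1)/2}`-component (`hW16`,
file `…LambdaAdicRed.lean`) in place of Kato's big-image reading — NO image hypothesis — and the whole-cell
form gluing X3♯(M) and X4(M) ∩ surj by `N10.cellM_iff_classX3M_or_classX4M`. HONEST FRAMING: named-fact
binders only (`hK`, `hW16`, `hDel`, `hDelX`, `hPal`, GZK, modularity, `hmodD`); the Λ-adic child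
`QuadraticBranchLowerDivisibilityAt` is NOT in print and NOT asserted (for reducible `V[p]` the cell's
object of record is `X3BranchMainConjectureAt`, lattice caveat of b2b p10); nothing booked; cell (M) stays
CONSTRUCTION-shaped. THEOREMS ONLY.

References: C. Wuthrich, Doc. Math. 19 (2014) Thm. 16 [Wuthrich2014]; K. Kato, Astérisque 295 (2004)
Thm. 17.4 (3) [Kato2004Asterisque]; R. Greenberg, LNM 1716 (1999) §5 [GreenbergLNM1716]; D. Delbourgo,
Compositio Math. 113 (1998) Prop. 4 [Delbourgo1998]; R. L. Miller, LMS J. Comput. Math. 14 (2011) Def. 1.1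
[Miller2011LMS].
-/

set_option autoImplicit false
set_option linter.dupNamespace false

noncomputable section

open scoped Classical MatrixGroups ModularForm

open CongruenceSubgroup WeierstrassCurve NumberField IsDedekindDomain
  Literature.NumberTheory.EllipticCurves
  Literature.NumberTheory.EllipticCurves.ModularForms
  Literature.NumberTheory.EllipticCurves.Rank1Residual
  Literature.NumberTheory.EllipticCurves.Rank1Residual.Typed
  Literature.NumberTheory.GaloisRepresentations

namespace Summit.BirchSwinnertonDyer.BirchSwinnertonDyer.Theorems.AdditiveBranchIMCMultLowerLambdaAdic

open Summit.BirchSwinnertonDyer.Rank1Residual.Additive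
open Summit.BirchSwinnertonDyer.Rank1Residual.AdditivePotMult
open Summit.BirchSwinnertonDyer.BirchSwinnertonDyer.Theorems.AdditiveBranchIMCMultLower

variable {W : WeierstrassCurve ℚ} [W.IsElliptic] [W.IsGloballyMinimal] {p : ℕ} [hp : Fact p.Prime]

/-! ## §1 The reducible rows X3♯(M): ascent and iff, NO image hypothesis (Wuthrich Thm. 16); §2 whole cell -/

/-- **X3♯(M), `r_an = 0`, EVERY odd `p`, `p ≡ 1 (mod 4)`: Miller ⟺ `T = 0`** (`p ∤ c_p` automatic on (M),
`ClassX3M.not_dvd_tamagawaNumberAt`). Bookkeeping; sharpens the LambdaAdicRed file's `p ≥ 5` version.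
[cite: Delbourgo1998, Prop. 4 (p. 144), §2.2 Lemma (ii) (p. 139)] [cite: Pal2012, Thm. 3.2]
[cite: SilvermanATAEC1994, IV.9.4 Steps 6–7] [cite: Miller2011LMS, Def. 1.1] -/
theorem missingLowerBoundAt_iff_chiBranchLowerLeadingTermAt_classX3M_rankZero_anyOdd
    (hDel : Delbourgo1998.prop4_rankZero_pow_dvd_constantCoeff)
    (hDelX : Delbourgo1998.prop4_rankZero_constantCoeff_eq_unit_mul_of_potMult)
    (hPal : Pal2012.thm32_sqrt_mul_realPeriodRat_twist_eq_of_prime_one_mod_four)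
    (hGZK : rank_eq_analyticRank_of_analyticRank_le_one) (hmod : hasEntireLFunction_rat)
    (hmodD : nonempty_modularParametrizationData)
    (hX : ClassX3M W p) (hp1 : p % 4 = 1) (hr : W.analyticRank = 0) :
    MissingLowerBoundAt W p ↔ ChiBranchLowerLeadingTermAt W p :=
  (missingLowerBoundAt_iff_cycLeadingTermDvdAt_of_potMult W p hDel hDelX hGZK hmod hX.2.2 hX.1.2 hX.2.1.2 hr
      (ClassX3M.not_dvd_tamagawaNumberAt hX)).trans
    ((cycLeadingTermDvdAt_iff_cycLowerLeadingTermAt W p).trans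
      (ClassX3M.cycLowerLeadingTermAt_iff_chiBranchLower hPal hmod hmodD hX hp1))

/-- **Odd-parity twin, EVERY odd `p`**: X3♯(M), `r_an = 0`, `p ≡ 3 (mod 4)`: Miller ⟺ `T = 0` odd input.
[cite: Delbourgo1998, Prop. 4 (p. 144), §2.2 Lemma (ii) (p. 139)] [cite: SilvermanATAEC1994, IV.9.4 Steps 6–7]
[cite: Miller2011LMS, Def. 1.1] -/
theorem missingLowerBoundAt_iff_chiBranchLowerLeadingTermOddAt_classX3M_rankZero_anyOdd
    (hDel : Delbourgo1998.prop4_rankZero_pow_dvd_constantCoeff)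
    (hDelX : Delbourgo1998.prop4_rankZero_constantCoeff_eq_unit_mul_of_potMult)
    (hGZK : rank_eq_analyticRank_of_analyticRank_le_one) (hmod : hasEntireLFunction_rat)
    (hmodD : nonempty_modularParametrizationData)
    (hX : ClassX3M W p) (hp3 : p % 4 = 3) (hr : W.analyticRank = 0) :
    MissingLowerBoundAt W p ↔ ChiBranchLowerLeadingTermOddAt W p :=
  (missingLowerBoundAt_iff_cycLeadingTermDvdAt_of_potMult W p hDel hDelX hGZK hmod hX.2.2 hX.1.2 hX.2.1.2 hr
      (ClassX3M.not_dvd_tamagawaNumberAt hX)).trans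
    ((cycLeadingTermDvdAt_iff_cycLowerLeadingTermAt W p).trans
      (ClassX3M.cycLowerLeadingTermAt_iff_chiBranchLowerOdd hmod hmodD hX hp3))

/-- **ASCENT on X3♯(M)** (every odd `p`, `r_an = 0`, `E[p]` reducible): `MissingLowerBoundAt W p` implies
`QuadraticBranchLowerDivisibilityAt V p` for every globally minimal twist model `V` — as in the X4(M) sibling with the
LambdaAdicRed file (`charIdeal_eq_span_wuthrich_of_missingLowerBoundAt_rankZero_mult_red[_odd]`, Wuthrich
2014 Thm. 16 half-eigen reading `hW16`) in place of Kato's big-image reading; no tower hypothesis.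
[cite: Wuthrich2014, Thm. 16 (p. 397)] [cite: GreenbergLNM1716, §5 (PDF p. 143)] [cite: Delbourgo1998, Prop. 4 (p. 144)] -/
theorem quadraticBranchLowerDivisibilityAt_of_missingLowerBoundAt_rankZero_mult_red
    (hW16 : Wuthrich2014.thm16_halfEigenCharIdeal_dvd_cyclotomicPrime)
    (hDel : Delbourgo1998.prop4_rankZero_pow_dvd_constantCoeff)
    (hDelX : Delbourgo1998.prop4_rankZero_constantCoeff_eq_unit_mul_of_potMult)
    (hPal : Pal2012.thm32_sqrt_mul_realPeriodRat_twist_eq_of_prime_one_mod_four)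
    (hGZK : rank_eq_analyticRank_of_analyticRank_le_one) (hmod : hasEntireLFunction_rat)
    (hmodD : nonempty_modularParametrizationData)
    (hX : ClassX3M W p) (hr : W.analyticRank = 0) (hlow : MissingLowerBoundAt W p)
    (V : WeierstrassCurve ℚ) [V.IsElliptic] [V.IsGloballyMinimal]
    (hVW : ∃ C : VariableChange ℚ, C • V.quadraticTwist ((-1) ^ (p / 2) * p : ℚ) = W) :
    QuadraticBranchLowerDivisibilityAt V p := by
  intro K _ _ _ F _ _ _ _ κ γ N _ f B hp2 hK2 hθ hB hκ hγ hcv hγK hγF hf D ϖ hϖ g hg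
  have hpS : ((-1 : ℚ) ^ (p / 2) * p) ≠ 0 :=
    mul_ne_zero (pow_ne_zero _ (by norm_num)) (Nat.cast_ne_zero.mpr hp.out.ne_zero)
  obtain ⟨C, hC⟩ := hVW
  have hnord : ¬ IsOrdinaryAt V p :=
    not_isOrdinaryAt_of_model_twist_of_padicValRat_j_neg V hpS ⟨C, hC⟩ hX.2.1.2
  obtain ⟨θ, hθ2⟩ := hθ
  have hθnr : θ ∉ Set.range (algebraMap ℚ K) := not_mem_range_algebraMap_of_sq_eq_pStar hθ2
  haveI : (V.quadraticTwist ((-1 : ℚ) ^ (p / 2) * p)).IsElliptic := V.isElliptic_quadraticTwist hpS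
  let D' : W.SelmerDualData κ γ :=
    ChiEigenSelmerInDualData.toSelmerDualData V K hK2 hθnr hθ2 p κ hC (galRange (K := ℚ) F)
      (isOpen_galRange F) (coprime_index_galRange_cyclotomic p F) hp2 hγK D
  have hg' : g ∈ D'.charIdeal := hg
  have hodd4 : p % 4 = 1 ∨ p % 4 = 3 := by
    obtain ⟨k, hk⟩ := hp.out.odd_of_ne_two hp2
    omega
  rcases hodd4 with hp1 | hp3
  · have heven : Even (p / 2) := ⟨p / 4, by omega⟩
    rw [if_pos heven] at hϖ
    have hCp : ∃ C : VariableChange ℚ, C • V.quadraticTwist (p : ℚ) = W :=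
      ⟨C, by rw [pStar_eq_self_of_mod_four_eq_one hp1] at hC; exact hC⟩
    obtain ⟨hV, hBmult⟩ : Mult V p ∧
        ((V.HasSplitMultiplicativeReductionAtPrime p ∧
            B = padicLFunctionPlusBranchMult f (1 : ℚ_[p]) (p / 2)) ∨
          (¬ V.HasSplitMultiplicativeReductionAtPrime p ∧
            B = padicLFunctionPlusBranchMult f (-1 : ℚ_[p]) (p / 2))) := by
      rcases hB with ⟨hord, -⟩ | ⟨hs, hB⟩ | ⟨hm, hns, hB⟩
      · exact absurd hord hnord
      · exact ⟨hs.hasMultiplicativeReductionAtPrime, Or.inl ⟨hs, by rw [hB, if_pos heven]⟩⟩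
      · exact ⟨hm, Or.inr ⟨hns, by rw [hB, if_pos heven]⟩⟩
    have hT0 : ChiBranchLowerLeadingTermAt W p :=
      (missingLowerBoundAt_iff_chiBranchLowerLeadingTermAt_classX3M_rankZero_anyOdd hDel hDelX hPal hGZK hmod
        hmodD hX hp1 hr).mp hlow
    obtain ⟨B₁, e, hB₁shape, -, gK, -, u, hchar, hιgK⟩ :=
      charIdeal_eq_span_wuthrich_of_chiBranchLowerLeadingTerm_rankZero_mult_red hW16 hPal hmod hX.1.2 hr hX.1.1
        hT0 V hp1 hCp hV hκ hγ hcv hf D' ϖ hϖ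
    have hBB : B₁ = B := by
      rcases hBmult with ⟨hs, hB⟩ | ⟨hns, hB⟩ <;> rcases hB₁shape with ⟨hs₁, hB₁⟩ | ⟨hns₁, hB₁⟩
      · rw [hB, hB₁]
      · exact absurd hs hns₁
      · exact absurd hs₁ hns
      · rw [hB, hB₁]
    rw [hchar] at hg'
    obtain ⟨k, hk⟩ := Ideal.mem_span_singleton'.mp hg'
    refine ⟨k * PowerSeries.C (u : ℤ_[p]), ?_⟩
    have hιC : iwasawaToPowerSeries p (PowerSeries.C (u : ℤ_[p])) =
        PowerSeries.C (((u : ℤ_[p]) : ℤ_[p]) : ℚ_[p]) := by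
      rw [iwasawaToPowerSeries, PowerSeries.map_C]
      rfl
    rw [← hk, ← hBB]
    simp only [map_mul, hιgK, hιC]
    ring
  · have hodd : ¬ Even (p / 2) := by rw [Nat.not_even_iff_odd]; exact ⟨p / 4, by omega⟩
    rw [if_neg hodd] at hϖ
    have hCp : ∃ C : VariableChange ℚ, C • V.quadraticTwist (-(p : ℚ)) = W :=
      ⟨C, by rw [pStar_eq_neg_of_mod_four_eq_three hp3] at hC; exact hC⟩
    obtain ⟨hV, hBmult⟩ : Mult V p ∧
        ((V.HasSplitMultiplicativeReductionAtPrime p ∧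
            B = padicLFunctionMinusBranchMult f (1 : ℚ_[p]) (p / 2)) ∨
          (¬ V.HasSplitMultiplicativeReductionAtPrime p ∧
            B = padicLFunctionMinusBranchMult f (-1 : ℚ_[p]) (p / 2))) := by
      rcases hB with ⟨hord, -⟩ | ⟨hs, hB⟩ | ⟨hm, hns, hB⟩
      · exact absurd hord hnord
      · exact ⟨hs.hasMultiplicativeReductionAtPrime, Or.inl ⟨hs, by rw [hB, if_neg hodd]⟩⟩
      · exact ⟨hm, Or.inr ⟨hns, by rw [hB, if_neg hodd]⟩⟩
    have hT0 : ChiBranchLowerLeadingTermOddAt W p :=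
      (missingLowerBoundAt_iff_chiBranchLowerLeadingTermOddAt_classX3M_rankZero_anyOdd hDel hDelX hGZK hmod
        hmodD hX hp3 hr).mp hlow
    obtain ⟨B₁, e, hB₁shape, -, gK, -, u, hchar, hιgK⟩ :=
      charIdeal_eq_span_wuthrich_of_chiBranchLowerLeadingTermOdd_rankZero_mult_red hW16 hmod hX.1.2 hr hX.1.1
        hT0 V hp3 hCp hV hκ hγ hcv hf D' ϖ hϖ
    have hBB : B₁ = B := by
      rcases hBmult with ⟨hs, hB⟩ | ⟨hns, hB⟩ <;> rcases hB₁shape with ⟨hs₁, hB₁⟩ | ⟨hns₁, hB₁⟩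
      · rw [hB, hB₁]
      · exact absurd hs hns₁
      · exact absurd hs₁ hns
      · rw [hB, hB₁]
    rw [hchar] at hg'
    obtain ⟨k, hk⟩ := Ideal.mem_span_singleton'.mp hg'
    refine ⟨k * PowerSeries.C (u : ℤ_[p]), ?_⟩
    have hιC : iwasawaToPowerSeries p (PowerSeries.C (u : ℤ_[p])) =
        PowerSeries.C (((u : ℤ_[p]) : ℤ_[p]) : ℚ_[p]) := by
      rw [iwasawaToPowerSeries, PowerSeries.map_C]
      rfl
    rw [← hk, ← hBB]
    simp only [map_mul, hιgK, hιC]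
    ring

/-- **X3♯(M), every odd `p` (`p = 3` included), `r_an = 0`: `MissingLowerBoundAt W p ↔ ∀ twist models V,
QuadraticBranchLowerDivisibilityAt V p`** — NO image hypothesis at all (reducible `E[p]`: Wuthrich Thm. 16
`hW16` replaces Kato's big-image reading; (⟸) is the crux shape's per-pair consumer).
[cite: Wuthrich2014, Thm. 16 (p. 397)] [cite: Delbourgo1998, Prop. 4 (p. 144), §2.2 Lemma (ii) (p. 139)]
[cite: Pal2012, Thm. 3.2] [cite: Miller2011LMS, Def. 1.1] -/
theorem missingLowerBoundAt_iff_forall_quadraticBranchLower_classX3M_rankZero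
    (hW16 : Wuthrich2014.thm16_halfEigenCharIdeal_dvd_cyclotomicPrime)
    (hDel : Delbourgo1998.prop4_rankZero_pow_dvd_constantCoeff)
    (hDelX : Delbourgo1998.prop4_rankZero_constantCoeff_eq_unit_mul_of_potMult)
    (hPal : Pal2012.thm32_sqrt_mul_realPeriodRat_twist_eq_of_prime_one_mod_four)
    (hGZK : rank_eq_analyticRank_of_analyticRank_le_one) (hmod : hasEntireLFunction_rat)
    (hmodD : nonempty_modularParametrizationData)
    (hX : ClassX3M W p) (hr : W.analyticRank = 0) :
    MissingLowerBoundAt W p ↔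
      ∀ (V : WeierstrassCurve ℚ) [V.IsElliptic] [V.IsGloballyMinimal],
        (∃ C : VariableChange ℚ, C • V.quadraticTwist ((-1) ^ (p / 2) * p : ℚ) = W) →
          QuadraticBranchLowerDivisibilityAt V p :=
  ⟨fun hlow V _ _ hVW ↦
      quadraticBranchLowerDivisibilityAt_of_missingLowerBoundAt_rankZero_mult_red hW16 hDel hDelX hPal hGZK
        hmod hmodD hX hr hlow V hVW,
    fun hΛ ↦ missingLowerBoundAt_rankZero_of_cellM_of_quadraticBranchLower hDelX hPal hGZK hmod hmodD
      ((N10.cellM_iff_classX3M_or_classX4M W p).mpr (Or.inl hX)) hr hΛ⟩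

/-- **Whole cell (M), `p ≥ 5`, `r_an = 0`, `Irr → Surj`: the crux's conclusion ⟺ its Λ-adic child** —
X3♯(M) rows by §1, X4(M) ∩ surj rows by the sibling file (Serre tower). The only rows of cell (M) not covered are the
irreducible NON-surjective ones (class O8 of the residual map) and `p = 3`.
[cite: Wuthrich2014, Thm. 16 (p. 397)] [cite: Kato2004Asterisque, Thm. 17.4 (3) (p. 273)]
[cite: SerreAbelianLadic1968, IV §3.4 Lemma 3] [cite: Miller2011LMS, Def. 1.1] -/
theorem missingLowerBoundAt_iff_forall_quadraticBranchLower_cellM_rankZero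
    (hK : Wuthrich2014.kato_halfEigenCharIdeal_dvd_cyclotomicPrime_of_surjective)
    (hW16 : Wuthrich2014.thm16_halfEigenCharIdeal_dvd_cyclotomicPrime)
    (hDel : Delbourgo1998.prop4_rankZero_pow_dvd_constantCoeff)
    (hDelX : Delbourgo1998.prop4_rankZero_constantCoeff_eq_unit_mul_of_potMult)
    (hPal : Pal2012.thm32_sqrt_mul_realPeriodRat_twist_eq_of_prime_one_mod_four)
    (hGZK : rank_eq_analyticRank_of_analyticRank_le_one) (hmod : hasEntireLFunction_rat)
    (hmodD : nonempty_modularParametrizationData)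
    (hc : N10.CellM W p) (hp5 : 5 ≤ p) (hr : W.analyticRank = 0) (himg : Irr W p → Surj W p) :
    MissingLowerBoundAt W p ↔
      ∀ (V : WeierstrassCurve ℚ) [V.IsElliptic] [V.IsGloballyMinimal],
        (∃ C : VariableChange ℚ, C • V.quadraticTwist ((-1) ^ (p / 2) * p : ℚ) = W) →
          QuadraticBranchLowerDivisibilityAt V p := by
  rcases (N10.cellM_iff_classX3M_or_classX4M W p).mp hc with hX | hX
  · exact missingLowerBoundAt_iff_forall_quadraticBranchLower_classX3M_rankZero hW16 hDel hDelX hPal hGZK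
      hmod hmodD hX hr
  · exact missingLowerBoundAt_iff_forall_quadraticBranchLower_classX4M_rankZero_of_surj hK hDel hDelX hPal
      hGZK hmod hmodD hX hp5 hr (himg hX.1.2.2)

end Summit.BirchSwinnertonDyer.BirchSwinnertonDyer.Theorems.AdditiveBranchIMCMultLowerLambdaAdic

end
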